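import Summits.KontsevichZagierPeriods.KontsevichZagierPeriods.Theorems.RootDecompRelativeModAbsoluteRegKernelPairLeOneP03
import Summits.KontsevichZagierPeriods.KontsevichZagierPeriods.Theorems.RootDecompRelativeModAbsoluteRegFoldingDegOneP13

/-!
(LANDED by the census seat decomp-kz-census-1 g7 `--supports stmt-KontsevichZagierPeriods-30572`; source lens-3 g9 landing package #2, critic decomp-kz-crit-1 g2 CLEARED §14–§17; generic docstrings added where the source had none.)

# `RegKernelPairDegOne`, the COMMON-LOGARITHM case (route `RootDecompRelativeModAbsolute`, support item
stmt-KontsevichZagierPeriods-30572) — PROVED · part 6 (core lemma)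

Cell `decomp-kz`, lens 3 (decomp-kz-lens-3 g9), §16 of the HOME file.  Item 30572 for ANY numbers `k, k'` of
regularised monomials, all LOGARITHMIC (`eᵢ = 1`) and sharing ONE argument function `κ₀` (`κᵢ = κ'ⱼ = κ₀`,
`ℚ`-semialgebraic on `G ∪ G'`, `κ₀ > −1`).  This part: `sum_regroup` (regrouping a family of monomials by
order), `of_sub_sub_sum_mem_relations` (integrand additivity for a finite family on a common domain) and the
core lemma `cyl_commonLog_mem_relations`: a representation on `P × (0,1)` with integrand
`a₀(x) + Σ_{m≤n} c_m(x) θ^m/(1+θκ(x))` whose fibre integrals vanish a.e. is a relation — TAYLOR DIVISION by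
`1 + κθ` (part P0x of the `RegFoldingDegOne` chain, §10.2), the fibre identity
`a₀ + Σ sₖ/(k+1) + R ℓ_{n+1,1}(κ) = 0` a.e., RIGIDITY `R κ = 0` a.e. (`mul_kappa_ae_eq_zero`, part 3: Baker at
the algebraic points of the smooth locus), restriction to the full-measure piece `{Rκ = 0}` where the integrand
IS a polynomial in `θ`, `foldsTo_cyl_polynomial`, and the a.e.-vanishing of the folded base integrand.
Part 7: the rung theorem `regKernelPairDegOne_of_commonLog`.

Source: `HOME/decomp-kz-lens-3/g9/RelativeModAbsoluteDegOneBands.lean` §16 (v4 sha256 cdc0980a098a56c0, 6637 l;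
farm rc 0 / 0 warn / 0 sorry; `#print axioms regKernelPairDegOne_of_commonLog` = propext, Classical.choice,
Quot.sound), extracted verbatim into the namespace of the landed chain.  No `sorry`; standard axioms.
References: Baker 1975 Thm 2.1 [tree: `baker_holds`]; [cite: KontsevichZagier2001, §1.2]; Bochnak–Coste–Roy 1998 §2.9.
-/

noncomputable section

open Set MeasureTheory Filter Topology
open scoped BigOperators
open Literature.NumberTheory.Transcendental Literature.ModelTheory.ExponentialFields

namespace Summit.KontsevichZagierPeriods.RootDecompRelativeModAbsolute.Rung30571

namespace RegularisedLogLayer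

/-- (PRIVATE copy — the chain module RegFoldingDegOneP05 keeps this lemma private because its landed twin lives in a farm-unbuilt HyperbolicBloch module.) Finite sums of `ℚ`-semialgebraic functions are `ℚ`-semialgebraic. [BCR 1998, Prop. 2.2.6] -/
private theorem isSemialgebraicFunOn_finset_sum {n : ℕ} {s : Set (Fin n → ℝ)} (hs : IsSemialgebraic ℚ s)
    {ι : Type*} (I : Finset ι) {f : ι → (Fin n → ℝ) → ℝ}
    (hf : ∀ i ∈ I, IsSemialgebraicFunOn ℚ s (f i)) :
    IsSemialgebraicFunOn ℚ s (fun x => ∑ i ∈ I, f i x) := by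
  classical
  induction I using Finset.induction_on with
  | empty => exact (isSemialgebraicFunOn_ratCast hs 0).congr fun x _ => by simp
  | insert a I ha ih =>
    have h1 : IsSemialgebraicFunOn ℚ s (f a) := hf a (Finset.mem_insert_self a I)
    have h2 := ih fun i hi => hf i (Finset.mem_insert_of_mem hi)
    refine (IsSemialgebraicFunOn.add_holds h1 h2).congr fun x _ => ?_
    simp only [Pi.add_apply, Finset.sum_insert ha]

section CommonLog

/-- Regrouping a finite family by the values of `M`. -/
theorem sum_regroup {k : ℕ} (M : Fin k → ℕ) (u : Fin k → ℝ) (φ : ℕ → ℝ) {n : ℕ}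
    (hM : ∀ i, M i ≤ n) :
    ∑ i, u i * φ (M i) =
      ∑ m ∈ Finset.range (n + 1), (∑ i, if M i = m then u i else 0) * φ m := by
  classical
  have h1 : ∀ i, u i * φ (M i) =
      ∑ m ∈ Finset.range (n + 1), (if M i = m then u i else 0) * φ m := by
    intro i
    rw [Finset.sum_eq_single (M i)]
    · simp
    · intro m _ hm
      simp [Ne.symm hm]
    · intro h
      exact absurd (Finset.mem_range.2 (Nat.lt_succ_of_le (hM i))) h
  simp_rw [h1]
  rw [Finset.sum_comm]
  refine Finset.sum_congr rfl fun m _ => ?_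
  rw [Finset.sum_mul]

/-- **Integrand additivity for a finite family on a common domain.** [KZ 2001, §1.2 rule (1)] -/
theorem of_sub_sub_sum_mem_relations {m : ℕ} (k : ℕ) :
    ∀ (V r₀ : KZ.IntegralRep m) (r : Fin k → KZ.IntegralRep m),
      r₀.domain = V.domain → (∀ i, (r i).domain = V.domain) →
      EqOn V.integrand (fun x => r₀.integrand x + ∑ i, (r i).integrand x) V.domain →
      KZ.of V - KZ.of r₀ - ∑ i, KZ.of (r i) ∈ KZ.relations := by
  classical
  induction k with
  | zero =>
    intro V r₀ r h0 hr hV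
    simp only [Finset.univ_eq_empty, Finset.sum_empty, sub_zero, add_zero] at hV ⊢
    refine AECongr.of_sub_of_mem_relations_of_indicator_ae V r₀ (ae_of_all _ fun x => ?_)
    rw [h0]
    by_cases hx : x ∈ V.domain
    · rw [indicator_of_mem hx, indicator_of_mem hx, hV hx]
    · rw [indicator_of_notMem hx, indicator_of_notMem hx]
  | succ k ih =>
    intro V r₀ r h0 hr hV
    have hD : IsSemialgebraic ℚ V.domain := V.isSemialgebraic_domain
    have hs0 : IsSemialgebraicFunOn ℚ V.domain r₀.integrand := by
      rw [← h0]; exact r₀.isSemialgebraicFunOn_integrand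
    have hsi : ∀ i, IsSemialgebraicFunOn ℚ V.domain (r i).integrand := by
      intro i; rw [← hr i]; exact (r i).isSemialgebraicFunOn_integrand
    have hi0 : IntegrableOn r₀.integrand V.domain := by
      rw [← h0]; exact r₀.integrableOn
    have hii : ∀ i, IntegrableOn (r i).integrand V.domain := by
      intro i; rw [← hr i]; exact (r i).integrableOn
    let V' : KZ.IntegralRep m :=
      ⟨V.domain, fun x => r₀.integrand x + ∑ i : Fin k, (r (Fin.castSucc i)).integrand x, hD,
        IsSemialgebraicFunOn.add_holds hs0
          (isSemialgebraicFunOn_finset_sum hD _ fun i _ => hsi (Fin.castSucc i)),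
        hi0.add (integrable_finsetSum _ fun i _ => hii (Fin.castSucc i))⟩
    have h1 := ih V' r₀ (fun i => r (Fin.castSucc i)) h0 (fun i => hr _) (fun x _ => rfl)
    have h2 : KZ.of V - KZ.of V' - KZ.of (r (Fin.last k)) ∈ KZ.integrandAddRel := by
      refine ⟨m, V, V', r (Fin.last k), rfl, hr _, fun x hx => ?_, rfl⟩
      show V.integrand x = (r₀.integrand x + ∑ i : Fin k, (r (Fin.castSucc i)).integrand x) +
          (r (Fin.last k)).integrand x
      rw [hV hx]
      dsimp only
      rw [Fin.sum_univ_castSucc]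
      ring
    have e : KZ.of V - KZ.of r₀ - ∑ i, KZ.of (r i) =
        (KZ.of V - KZ.of V' - KZ.of (r (Fin.last k))) +
          (KZ.of V' - KZ.of r₀ - ∑ i : Fin k, KZ.of (r (Fin.castSucc i))) := by
      rw [Fin.sum_univ_castSucc]; abel
    rw [e]
    exact add_mem (KZ.integrandAddRel_subset_relations h2) h1

/-- **Core lemma (one common logarithm).** A representation `V` on the cylinder `P × (0,1)` whose
integrand is `a₀(x) + Σ_{m ≤ n} c_m(x)·θ^m/(1 + θ κ(x))` (`a₀, c_m, κ` `ℚ`-semialgebraic on `P`,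
`κ > −1` on `P`) and whose fibre integrals `a₀ + Σ c_m ℓ_{m,1}(κ)` vanish a.e. on `P` is a relation.
[Baker1975 Thm 2.1; KZ 2001 §1.2; this file §10.2, §14] -/
theorem cyl_commonLog_mem_relations {P : Set (Fin 1 → ℝ)} (hP : IsSemialgebraic ℚ P)
    (V : KZ.IntegralRep (1 + 1)) {a₀ κ : (Fin 1 → ℝ) → ℝ} (n : ℕ) {c : ℕ → (Fin 1 → ℝ) → ℝ}
    (ha₀ : IsSemialgebraicFunOn ℚ P a₀) (hκs : IsSemialgebraicFunOn ℚ P κ)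
    (hc : ∀ m, IsSemialgebraicFunOn ℚ P (c m)) (hκ1 : ∀ x ∈ P, -1 < κ x)
    (hdom : V.domain = RTerm.cyl P)
    (hint : EqOn V.integrand (fun z => a₀ (Fin.init z) +
      ∑ m ∈ Finset.range (n + 1),
        c m (Fin.init z) * kernel m 1 (κ (Fin.init z)) (z (Fin.last 1))) V.domain)
    (hzero : ∀ᵐ x, x ∈ P → a₀ x + ∑ m ∈ Finset.range (n + 1), c m x * ell m 1 (κ x) = 0) :
    KZ.of V ∈ KZ.relations := by
  classical
  have hPm : MeasurableSet P := hP.measurableSet_holds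
  -- Taylor division data
  set s : ℕ → (Fin 1 → ℝ) → ℝ := fun k x => tayCoeff n (fun i => c i x) (κ x) k with hs_def
  set R : (Fin 1 → ℝ) → ℝ := fun x => tayRem n (fun i => c i x) (κ x) with hR_def
  have hs : ∀ k, IsSemialgebraicFunOn ℚ P (s k) := fun k =>
    isSemialgebraicFunOn_tayCoeff hP n hc hκs k
  have hR : IsSemialgebraicFunOn ℚ P R := isSemialgebraicFunOn_tayRem hP n hc hκs
  -- the division identity on the cylinder
  have hdiv : ∀ x ∈ P, ∀ θ ∈ Ioo (0 : ℝ) 1,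
      ∑ m ∈ Finset.range (n + 1), c m x * kernel m 1 (κ x) θ =
        ∑ k ∈ Finset.range (n + 1), s k x * θ ^ k + R x * kernel (n + 1) 1 (κ x) θ := by
    intro x hx θ hθ
    have hpos : 0 < 1 + θ ^ 1 * κ x := one_add_pow_mul_pos 1 (hκ1 x hx) (Ioo_subset_Icc_self hθ)
    rw [pow_one] at hpos
    have hne : 1 + κ x * θ ≠ 0 := by rw [mul_comm]; exact hpos.ne'
    have e1 : ∑ m ∈ Finset.range (n + 1), c m x * kernel m 1 (κ x) θ =
        (∑ i ∈ Finset.range (n + 1), c i x * θ ^ i) / (1 + κ x * θ) := by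
      rw [Finset.sum_div]
      refine Finset.sum_congr rfl fun i _ => ?_
      simp only [kernel, pow_one]
      rw [mul_comm θ (κ x)]
      ring
    rw [e1, taylor_div n (fun i => c i x) (κ x) θ hne]
    simp only [hs_def, hR_def, kernel, pow_one]
    rw [mul_comm θ (κ x)]
    ring
  -- the fibre-integral identity
  have hI : ∀ x ∈ P, ∑ m ∈ Finset.range (n + 1), c m x * ell m 1 (κ x) =
      ∑ k ∈ Finset.range (n + 1), s k x / ((k : ℝ) + 1) + R x * ell (n + 1) 1 (κ x) := by
    intro x hx
    have hk1 := hκ1 x hx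
    have i1 : ∀ k ∈ Finset.range (n + 1),
        Integrable (fun θ : ℝ => s k x * θ ^ k) (volume.restrict (Ioo (0 : ℝ) 1)) := by
      intro k _
      have : IntegrableOn (fun θ : ℝ => θ ^ k) (Ioo (0 : ℝ) 1) :=
        ((continuous_pow k).integrableOn_Icc (a := (0 : ℝ)) (b := 1)).mono_set Ioo_subset_Icc_self
      exact this.const_mul _
    have i2 : Integrable (fun θ : ℝ => ∑ k ∈ Finset.range (n + 1), s k x * θ ^ k)
        (volume.restrict (Ioo (0 : ℝ) 1)) := integrable_finsetSum _ i1
    have i3 : Integrable (fun θ : ℝ => R x * kernel (n + 1) 1 (κ x) θ)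
        (volume.restrict (Ioo (0 : ℝ) 1)) := (integrableOn_kernel (n + 1) 1 hk1).const_mul _
    have lhs : ∑ m ∈ Finset.range (n + 1), c m x * ell m 1 (κ x) =
        ∫ θ in Ioo (0 : ℝ) 1, ∑ m ∈ Finset.range (n + 1), c m x * kernel m 1 (κ x) θ := by
      rw [integral_finsetSum _ (fun m _ => (integrableOn_kernel m 1 hk1).const_mul _)]
      refine Finset.sum_congr rfl fun m _ => ?_
      rw [integral_const_mul]
      rfl
    rw [lhs, setIntegral_congr_fun measurableSet_Ioo (fun θ hθ => hdiv x hx θ hθ),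
      integral_add i2 i3, integral_finsetSum _ i1, integral_const_mul]
    congr 1
    · refine Finset.sum_congr rfl fun k _ => ?_
      rw [integral_const_mul, integral_pow_Ioo]
      ring
  -- rigidity: `R κ = 0` a.e. on `P`
  set g₀ : (Fin 1 → ℝ) → ℝ := fun x =>
    a₀ x + ∑ k ∈ Finset.range (n + 1), s k x / ((k : ℝ) + 1) with hg₀_def
  have hg₀ : IsSemialgebraicFunOn ℚ P g₀ := by
    refine IsSemialgebraicFunOn.add_holds ha₀ (isSemialgebraicFunOn_finset_sum hP _ fun k _ => ?_)
    exact (IsSemialgebraicFunOn.mul_holds (hs k)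
      (isSemialgebraicFunOn_ratCast hP ((1 : ℚ) / ((k : ℕ) + 1)))).congr fun x _ => by
        simp [div_eq_mul_inv]
  have hrig : ∀ᵐ x, x ∈ P → R x * κ x = 0 := by
    refine mul_kappa_ae_eq_zero hP isSemialgebraic_empty hg₀ (g₀' := fun _ => (0 : ℝ))
      ((isSemialgebraicFunOn_ratCast isSemialgebraic_empty 0).congr fun x _ => by simp)
      hR hκs hκ1 (M := n + 1) (e := 1) (Or.inl rfl) ?_
    filter_upwards [hzero] with x hx
    simp only [Set.indicator_empty]
    by_cases hxP : x ∈ P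
    · rw [indicator_of_mem hxP]
      have h1 := hx hxP
      rw [hI x hxP] at h1
      show g₀ x + R x * ell (n + 1) 1 (κ x) = 0
      simp only [hg₀_def]
      linarith
    · rw [indicator_of_notMem hxP]
  -- restrict to the full-measure piece `P₀ = {R κ = 0}`
  set P₀ : Set (Fin 1 → ℝ) := {x | x ∈ P ∧ R x * κ x = 0} with hP₀_def
  have hP₀ : IsSemialgebraic ℚ P₀ :=
    isSemialgebraic_sep_eq_zero (IsSemialgebraicFunOn.mul_holds hR hκs)
  have hP₀m : MeasurableSet P₀ := hP₀.measurableSet_holds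
  have hP₀P : P₀ ⊆ P := fun x hx => hx.1
  have hnull : volume (P \ P₀) = 0 := by
    rw [measure_eq_zero_iff_ae_notMem]
    filter_upwards [hrig] with x hx hx'
    exact hx'.2 ⟨hx'.1, hx hx'.1⟩
  have hcylP₀ : IsSemialgebraic ℚ (RTerm.cyl P₀) := RTerm.isSemialgebraic_cyl hP₀
  have hsub₀ : RTerm.cyl P₀ ⊆ V.domain := by
    rw [hdom]; exact fun z hz => ⟨hP₀P hz.1, hz.2⟩
  let V₀ : KZ.IntegralRep (1 + 1) := V.restrict _ hcylP₀ hsub₀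
  have hVV₀ : KZ.of V - KZ.of V₀ ∈ KZ.relations := by
    refine KZ.IntegralRep.of_sub_of_restrict_mem_relations V hcylP₀ hsub₀ ?_
    refine measure_mono_null (fun z hz => ?_) (KZ.volume_setOf_init_mem_eq_zero hnull)
    have hz1 : z ∈ RTerm.cyl P := hdom ▸ hz.1
    refine ⟨hz1.1, fun h0 => hz.2 ⟨h0, hz1.2⟩⟩
  -- the polynomial coefficients
  set aN : ℕ → (Fin 1 → ℝ) → ℝ := fun k x =>
    (if k = 0 then a₀ x else 0) + (if k ≤ n then s k x else R x) with haN_def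
  set a : Fin (n + 1 + 1) → (Fin 1 → ℝ) → ℝ := fun k x => aN k x with ha_def
  have haN : ∀ k, IsSemialgebraicFunOn ℚ P₀ (aN k) := by
    intro k
    refine IsSemialgebraicFunOn.add_holds ?_ ?_
    · by_cases hk : k = 0
      · simp only [hk, if_true]; exact ha₀.mono hP₀P hP₀
      · simp only [hk, if_false]
        exact (isSemialgebraicFunOn_ratCast hP₀ 0).congr fun x _ => by simp
    · by_cases hk : k ≤ n
      · simp only [hk, if_true]; exact (hs k).mono hP₀P hP₀
      · simp only [hk, if_false]; exact hR.mono hP₀P hP₀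
  have ha : ∀ k, IsSemialgebraicFunOn ℚ P₀ (a k) := fun k => haN k
  have hsumA : ∀ (x : Fin 1 → ℝ) (θ : ℝ), ∑ k : Fin (n + 1 + 1), a k x * θ ^ (k : ℕ) =
      a₀ x + (∑ k ∈ Finset.range (n + 1), s k x * θ ^ k + R x * θ ^ (n + 1)) := by
    intro x θ
    rw [Fin.sum_univ_eq_sum_range (fun k => aN k x * θ ^ k) (n + 1 + 1), Finset.sum_range_succ]
    have h1 : ∑ k ∈ Finset.range (n + 1), aN k x * θ ^ k =
        a₀ x + ∑ k ∈ Finset.range (n + 1), s k x * θ ^ k := by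
      have h2 : ∀ k ∈ Finset.range (n + 1), aN k x * θ ^ k =
          (if k = 0 then a₀ x else 0) * θ ^ k + s k x * θ ^ k := by
        intro k hk
        have hk' : k ≤ n := by simpa [Finset.mem_range, Nat.lt_succ_iff] using hk
        simp only [haN_def, hk', if_true]
        ring
      rw [Finset.sum_congr rfl h2, Finset.sum_add_distrib]
      congr 1
      rw [Finset.sum_eq_single 0]
      · simp
      · intro k _ hk; simp [hk]
      · intro h; exact absurd (Finset.mem_range.2 (Nat.succ_pos n)) h
    rw [h1]
    have h3 : aN (n + 1) x = R x := by
      simp only [haN_def, Nat.succ_ne_zero, if_false, zero_add]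
      simp
    rw [h3]
    ring
  have hsumB : ∀ x : Fin 1 → ℝ, ∑ k : Fin (n + 1 + 1), a k x / ((k : ℕ) + 1) =
      g₀ x + R x / ((n : ℝ) + 2) := by
    intro x
    rw [Fin.sum_univ_eq_sum_range (fun k => aN k x / ((k : ℝ) + 1)) (n + 1 + 1),
      Finset.sum_range_succ]
    have h1 : ∑ k ∈ Finset.range (n + 1), aN k x / ((k : ℝ) + 1) =
        a₀ x + ∑ k ∈ Finset.range (n + 1), s k x / ((k : ℝ) + 1) := by
      have h2 : ∀ k ∈ Finset.range (n + 1), aN k x / ((k : ℝ) + 1) =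
          (if k = 0 then a₀ x else 0) / ((k : ℝ) + 1) + s k x / ((k : ℝ) + 1) := by
        intro k hk
        have hk' : k ≤ n := by simpa [Finset.mem_range, Nat.lt_succ_iff] using hk
        simp only [haN_def, hk', if_true]
        ring
      rw [Finset.sum_congr rfl h2, Finset.sum_add_distrib]
      congr 1
      rw [Finset.sum_eq_single 0]
      · simp
      · intro k _ hk; simp [hk]
      · intro h; exact absurd (Finset.mem_range.2 (Nat.succ_pos n)) h
    rw [h1]
    have h3 : aN (n + 1) x = R x := by
      simp only [haN_def, Nat.succ_ne_zero, if_false, zero_add]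
      simp
    rw [h3]
    simp only [hg₀_def]
    push_cast
    ring
  -- the integrand of `V₀` IS the polynomial, pointwise on `cyl P₀`
  have hpt : ∀ x ∈ P₀, ∀ t ∈ Ioo (0 : ℝ) 1,
      V₀.integrand (Fin.snoc x t) = ∑ k : Fin (n + 1 + 1), a k x * t ^ (k : ℕ) := by
    intro x hx t ht
    have hmem : (Fin.snoc x t : Fin (1 + 1) → ℝ) ∈ V.domain := by
      rw [hdom]
      refine ⟨?_, ?_⟩
      · rw [Fin.init_snoc]; exact hx.1
      · rw [Fin.snoc_last]; exact ht
    show V.integrand (Fin.snoc x t) = _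
    rw [hint hmem]
    simp only [Fin.init_snoc, Fin.snoc_last]
    rw [hdiv x hx.1 t ht, hsumA]
    rcases mul_eq_zero.1 hx.2 with h0 | h0
    · simp [h0]
    · simp [kernel, h0]
  -- fold the polynomial representation `V₀` (termwise integrability is inside the lemma)
  obtain ⟨hTb, hfold⟩ := foldsTo_cyl_polynomial V₀ hP₀ ha rfl (fun z hz => by
    have hz' : z ∈ RTerm.cyl P₀ := hz
    have e := hpt (Fin.init z) hz'.1 (z (Fin.last 1)) hz'.2
    rw [Fin.snoc_init_self] at e
    exact e)
  have hV₀B : KZ.of V₀ - KZ.of (RTerm.baseRep _ hTb) ∈ KZ.relations := by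
    have := hfold.1
    rwa [RTerm.unfold_base] at this
  -- the base term has a.e.-zero integrand
  set B := RTerm.baseRep _ hTb with hB_def
  let Z : KZ.IntegralRep 1 := B.restrict ∅ isSemialgebraic_empty (empty_subset _)
  have hZ : KZ.of Z ∈ KZ.relations :=
    KZ.of_mem_relations_of_volume_eq_zero Z (by simp [Z])
  have hBZ : KZ.of B - KZ.of Z ∈ KZ.relations := by
    refine AECongr.of_sub_of_mem_relations_of_indicator_ae B Z ?_
    filter_upwards [hzero] with x hx
    rw [show Z.domain = ∅ from rfl, Set.indicator_empty]
    by_cases hxP₀ : x ∈ P₀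
    · rw [show B.domain = P₀ from rfl, indicator_of_mem hxP₀]
      show ∑ k : Fin (n + 1 + 1), a k x / ((k : ℕ) + 1) = 0
      rw [hsumB]
      have h1 := hx hxP₀.1
      rw [hI x hxP₀.1] at h1
      have h2 : R x * ell (n + 1) 1 (κ x) = R x / ((n : ℝ) + 2) := by
        rcases mul_eq_zero.1 hxP₀.2 with h0 | h0
        · simp [h0]
        · rw [h0, ell_at_zero]
          push_cast
          ring
      simp only [hg₀_def]
      linarith
    · rw [show B.domain = P₀ from rfl, indicator_of_notMem hxP₀]
  have e : KZ.of V = (KZ.of V - KZ.of V₀) + ((KZ.of V₀ - KZ.of B) + ((KZ.of B - KZ.of Z) + KZ.of Z)) := by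
    abel
  rw [e]
  exact add_mem hVV₀ (add_mem hV₀B (add_mem hBZ hZ))

end CommonLog

end RegularisedLogLayer

end Summit.KontsevichZagierPeriods.RootDecompRelativeModAbsolute.Rung30571

end
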